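import Summits.QuantumFields.BalabanUV.Beta.FP.SliceBiContactChart
import Summits.QuantumFields.BalabanUV.Beta.FP.PerfectPairSiteSwap
import Summits.QuantumFields.BalabanUV.Beta.SymShiftedSpread

/-!
# `BalabanUV.Beta.FP.SliceKcovChartAssembly` — road «FP», binder row D1, sub-row **H2-ASM-5a (Kcov)**, module R10: **THE CHART SHAPE OF THE TOTAL GLUON DATA,
# ASSEMBLED IN THE «STRAIGHT» BRANCH** — given the perfect action's jets `(S₃, S₄)` with (Sr-conj)∕(Wr-conj) laws against the `Δ_∞` block `MFˢˢ − ddKer` (the letters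
# N0b-S (a7) owes, DISPLAYED as hypotheses), the TOTAL data `(S₃ + sliceA, S₄ + sliceW)` obeys the (Sr-conj)∕(Wr-conj) laws against the site-swapped perfect
# Feynman form `MFˢˢ` with an2's diagonal generators — exactly the shape R6 (`conj_defect_bdd`) consumes at the leg `Pkerˢˢ` (R9: (P-INV)ˢˢ ✓)

HONEST DEPENDENCY (page 1, mandatory): continuum YM on T⁴ ⇐ BetaPertH ∧ nine spine estimates (0/9 proved); BetaPertH ⇐ (D1) ∧ (D4) ∧ CAP+tail;
G-an2-4 gates asym, D1 and NE2/3/4.  HONEST FRAMING (cell contract, verbatim): «discharging `BetaPertH` makes Bałaban's UV stability UNCONDITIONAL —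
a real constructive-QFT result; it is NOT the continuum limit and NOT the Clay problem.»  THIS MODULE DISCHARGES NOTHING of the wall: additivity of an5's
contact objects for DIAGONAL generators (entrywise, R8's `conjW_diagK_apply`; first order = an2's `SymShiftedSpread.conjV_add_diagK`) + R7 ∕ R8 BY NAME; the perfect jets' laws `hS₃` ∕ `hS₄` are HYPOTHESES (N0b-S),
asserted nowhere; 0 def, 0 `def … : Prop`, nothing cited, 0 sorry; 0∕4 row-D1 binders.  The convention pin N-d1leaf02g10-3 is NOT decided here: this is the
«STRAIGHT» branch (leg `Pkerˢˢ`, form `MFˢˢ = MFᶠ`, jets as typed) of gan24-leaf-02-g41's two-branch display (`SliceGaugeLawAssembly`); the «FIBRE» branch has no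
counterpart for REFLECTIONS with the same leg map (the cell's `Φ N α` re-bases sites PER FIBRE INDEX, so fibre-transposed jets do not obey the law against it —
remark, not a theorem).  NOT the (Kcov) instance, NOT H2V-4, NOT D1, NOT BetaPertH, NOT continuum, NOT Clay.

ABSOLUTE RULE (cell charter, verbatim): «No internally-minted statement may enter as a cited fact. Every hypothesis is either kernel-proved in this package or a
verbatim quotation of a PUBLISHED theorem with page reference. The manuscript(s) under audit are NOT citable for their own disputed steps — they are the thing
under adjudication; programme-internal (2001/route/tribunal) claims are never citable.»

CONTENT.  §1 additivity for diagonal generators: first order = an2's `SymShiftedSpread.conjV_add_diagK` BY NAME (a v1 draft restating it bounced `dedup.landed`);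
`conjW_add_diagK` (`conjW (M₁ + M₂) (V₁ + V₂) (V₁′ + V₂′) X X′ X₂ = conjW M₁ V₁ V₁′ X X′ X₂ + conjW M₂ V₂ V₂′ X X′ X₂` for diagonal `X, X′`, `X₂ = diagK (g·g′)`).
§2 **`srConj_total`**, **`wrConj_total`**: the laws of `S₃ + sliceA` and `S₄ + sliceW` against `MFˢˢ := fun x z a b => MF z x a b` from the displayed laws of `S₃`, `S₄`
against `MFˢˢ − ddKer` (generators `diagK (−ctGen 3 α L κ u)`, `X₂ = diagK (ctGen·ctGen′)`, a free `Loc`-style remainder `Rm` carried through the W-law).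
Provenance: D1 formalisation swarm seat b2b-balaban-beta-d1-formalise-leaf-02 gen 10 (road FP engine lineage; sub-row H2-ASM-5a (Kcov)), 2026-08-21.
-/

noncomputable section

namespace Summit.QuantumFields.BalabanUV.Beta.FP.SliceKcovChartAssembly

open Finset
open scoped BigOperators
open Literature.MathematicalPhysics.QuantumFieldTheory.Balaban1983to89
open Literature.MathematicalPhysics.QuantumFieldTheory.Balaban1983to89.Beta
open ExpKernelCalculus (MKer Site comp)
open KernelReflection (refK refK_apply)
open PolarizationSign (reflSign)
open ResolventReflection (bref Φ)
open OneStepResolventKernel (Fib)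
open Summit.QuantumFields.BalabanUV.Beta.ChartConjugation (conjV conjW)
open Summit.QuantumFields.BalabanUV.Beta.BorderedHessian (diagK ctGen conjV_diagK_apply)
open Summit.QuantumFields.BalabanUV.Beta.SymShiftedSpread (conjV_add_diagK)
open Summit.QuantumFields.BalabanUV.Beta.FP.SliceVertex (sliceA)
open Summit.QuantumFields.BalabanUV.Beta.FP.SliceBiStencil (sliceW)
open Summit.QuantumFields.BalabanUV.Beta.FP.SliceGaugeLaw (ddKer)
open Summit.QuantumFields.BalabanUV.Beta.FP.PerfectPropagatorInverse (MF)
open Summit.QuantumFields.BalabanUV.Beta.FP.SliceContactChart (sliceA_bref_conj)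
open Summit.QuantumFields.BalabanUV.Beta.FP.SliceBiContactChart (conjW_diagK_apply sliceW_bref_conj)

/-! ## §1 Additivity of the chart contacts for diagonal generators -/

section Additive

variable {d : ℕ}

/-- [folklore] **THE SECOND-ORDER CHART CONTACT IS ADDITIVE IN (FORM, VERTEX PAIR)** for diagonal generators `X = diagK g`, `X′ = diagK g′`, `X₂ = diagK (g·g′)`:
`conjW (M₁ + M₂) (V₁ + V₂) (V₁′ + V₂′) X X′ X₂ = conjW M₁ V₁ V₁′ X X′ X₂ + conjW M₂ V₂ V₂′ X X′ X₂` (the first-order piece is linear in each vertex slot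
separately, the quadratic piece linear in the form). -/
theorem conjW_add_diagK (M₁ M₂ V₁ V₂ V₁' V₂' : MKer (d + 1) (Fib d)) (g g' : (Fin (d + 1) → ℤ) → Fib d → ℝ) :
    conjW (M₁ + M₂) (V₁ + V₂) (V₁' + V₂') (diagK g) (diagK g') (diagK (fun y c => g y c * g' y c)) =
      conjW M₁ V₁ V₁' (diagK g) (diagK g') (diagK (fun y c => g y c * g' y c))
        + conjW M₂ V₂ V₂' (diagK g) (diagK g') (diagK (fun y c => g y c * g' y c)) := by
  funext x z a b
  rw [Pi.add_apply, Pi.add_apply, Pi.add_apply, Pi.add_apply, conjW_diagK_apply, conjW_diagK_apply, conjW_diagK_apply]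
  simp only [Pi.add_apply]
  ring

end Additive

/-! ## §2 The total gluon data in the «straight» branch -/

section Total

variable (N L : ℕ) {S₃ : Fin 4 → Site 4 → MKer 4 (Fib 3)} {S₄ : Fin 4 → Site 4 → Fin 4 → Site 4 → MKer 4 (Fib 3)}
  {Rm : Fin 4 → Fin 4 → Site 4 → Fin 4 → Site 4 → MKer 4 (Fib 3)}

/-- [our object] **THE FIRST-ORDER LAW OF THE TOTAL CUBIC DATA, «STRAIGHT» BRANCH.**  DISPLAYED HYPOTHESIS `hS₃` (N0b-S (a7) in (Sr-conj) form, asserted nowhere):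
the perfect action's cubic jets obey the bond-reflection law against the cell's leg map `Φ N α` with the chart contact of the `Δ_∞` block `MFˢˢ − ddKer` and
an2's negated product-chart generator.  CONCLUSION: the total family `κ u ↦ S₃ κ u + sliceA 3 κ u` obeys the same law with the chart contact of the WHOLE
site-swapped perfect Feynman form `MFˢˢ` (R7 `sliceA_bref_conj` supplies the slice share). -/
theorem srConj_total
    (hS₃ : ∀ (α κ : Fin 4) (u : Site 4), S₃ κ (bref α κ u) = reflSign α κ • refK (Φ N α)
      (S₃ κ u + conjV ((fun x z a b => MF z x a b) - ddKer) (diagK (fun y c => -ctGen 3 α L κ u y c))))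
    (α κ : Fin 4) (u : Site 4) :
    (fun κ u => S₃ κ u + sliceA 3 κ u) κ (bref α κ u) = reflSign α κ • refK (Φ N α)
      ((fun κ u => S₃ κ u + sliceA 3 κ u) κ u + conjV (fun x z a b => MF z x a b) (diagK (fun y c => -ctGen 3 α L κ u y c))) := by
  have e : (fun x z (a b : Fib 3) => MF z x a b) = ((fun x z a b => MF z x a b) - ddKer) + ddKer := (sub_add_cancel _ _).symm
  show S₃ κ (bref α κ u) + sliceA 3 κ (bref α κ u) = _
  rw [hS₃ α κ u, sliceA_bref_conj N L α κ u]
  conv_rhs => rw [e, conjV_add_diagK]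
  funext x z a b
  simp only [Pi.smul_apply, Pi.add_apply, smul_eq_mul, refK_apply]
  ring

/-- [our object] **THE SECOND-ORDER LAW OF THE TOTAL QUARTIC DATA, «STRAIGHT» BRANCH.**  DISPLAYED HYPOTHESIS `hS₄` ((Wr-conj-rem) form for the perfect jets against
`MFˢˢ − ddKer`, with the cubic jets `S₃` in the first-order slots, the same generators, `X₂ = diagK (ctGen·ctGen′)`, and a free remainder `Rm`).  CONCLUSION: the total
bi-table `S₄ + sliceW 3` obeys the law against `MFˢˢ` with the TOTAL cubic data in the first-order slots and the same remainder (R8 `sliceW_bref_conj` supplies the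
slice share, remainder-free). -/
theorem wrConj_total
    (hS₄ : ∀ (α κ : Fin 4) (u : Site 4) (κ' : Fin 4) (u' : Site 4), S₄ κ (bref α κ u) κ' (bref α κ' u') = (reflSign α κ * reflSign α κ') • refK (Φ N α)
      (S₄ κ u κ' u' + conjW ((fun x z a b => MF z x a b) - ddKer) (S₃ κ u) (S₃ κ' u') (diagK (fun y c => -ctGen 3 α L κ u y c))
        (diagK (fun y c => -ctGen 3 α L κ' u' y c)) (diagK (fun y c => ctGen 3 α L κ u y c * ctGen 3 α L κ' u' y c)) + Rm α κ u κ' u'))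
    (α κ : Fin 4) (u : Site 4) (κ' : Fin 4) (u' : Site 4) :
    (fun κ u κ' u' => S₄ κ u κ' u' + sliceW 3 κ u κ' u') κ (bref α κ u) κ' (bref α κ' u') = (reflSign α κ * reflSign α κ') • refK (Φ N α)
      ((fun κ u κ' u' => S₄ κ u κ' u' + sliceW 3 κ u κ' u') κ u κ' u'
        + conjW (fun x z a b => MF z x a b) ((fun κ u => S₃ κ u + sliceA 3 κ u) κ u) ((fun κ u => S₃ κ u + sliceA 3 κ u) κ' u')
            (diagK (fun y c => -ctGen 3 α L κ u y c)) (diagK (fun y c => -ctGen 3 α L κ' u' y c))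
            (diagK (fun y c => ctGen 3 α L κ u y c * ctGen 3 α L κ' u' y c))
        + Rm α κ u κ' u') := by
  have e : (fun x z (a b : Fib 3) => MF z x a b) = ((fun x z a b => MF z x a b) - ddKer) + ddKer := (sub_add_cancel _ _).symm
  have hX₂ : (fun y c => ctGen 3 α L κ u y c * ctGen 3 α L κ' u' y c) =
      (fun y c => (fun y c => -ctGen 3 α L κ u y c) y c * (fun y c => -ctGen 3 α L κ' u' y c) y c) := by
    funext y c; ring
  show S₄ κ (bref α κ u) κ' (bref α κ' u') + sliceW 3 κ (bref α κ u) κ' (bref α κ' u') = _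
  rw [hS₄ α κ u κ' u', sliceW_bref_conj N L α κ u κ' u']
  conv_rhs => rw [e, hX₂, conjW_add_diagK, ← hX₂]
  funext x z a b
  simp only [Pi.smul_apply, Pi.add_apply, smul_eq_mul, refK_apply]
  ring

end Total

end Summit.QuantumFields.BalabanUV.Beta.FP.SliceKcovChartAssembly

end
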